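import Literature.MathematicalPhysics.QuantumFieldTheory.Balaban1983to89.B12Eq213CouplingDependence

/-!
# `Balaban1983to89.B12Eq213HistoryTower` — T. Bałaban, *Renormalization group approach to lattice gauge field
theories. I*, Commun. Math. Phys. **109** (1987) 249–301 [Balaban1987RG1], (0.23) p. 256, (2.12)–(2.13) p. 268, p. 298:
**the TOWER of new terms generated by the (2.13) body under two coupling histories — the a-priori (un-localised)
history-Lipschitz bound of the total small-field action, `|𝐄_k(g′; U) − 𝐄_k(g; U)| ≤ Σ_{i<k} (L + L_R)·3^{k−1−i}·|g′_i − g_i|`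
on the small-field domains, kernel-checked on the body of record**

statement-level skeleton of published theorems with citation tags; proofs where landed; nothing here is a claim about
the Yang–Mills mass gap

PDF held: `paper:balaban1987-cmp109-rg-i-small-field` (journal page = PDF page + 248); pp. 256, 263, 268, 298 re-read this
session from the text layer.

CITATION HEADER / WHAT IS REPRODUCED (cell `pub-ymgap`, HUMAN RULING D-0062 Track A, seat `pub-ymgap-dag-n22-b` = the
FIRST-MISSING-ESTIMATE seat of DAG node N22 = spine estimate NE9 «joint Lipschitz dependence on the coupling history with
fading memory»; third module of the body-level chain (dag-lead [DAGLEAD-G0-REBALANCE-5] (2): «STAY on the body-level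
chain»), a NEW LEAF over the seat's `B12Eq213CouplingDependence` (p409146 ✓ de7c67c6d7f5), nothing there modified).

THE PRINT.  p. 256 [PDF 8] (0.23): *«Thus we obtain after k steps 𝐄_k(U_k) = Σ_{j=1}^{k} [−β_j(g_{j−1})A^η(U_k) + 𝐄^{(j)}(U_k)].
(0.23) … The function 𝐄_k depends also on the effective coupling constants g₀, …, g_{k−1}. It is a sum of contributions
coming from the k successive integrations in the k renormalization transformations.»*; p. 268 [PDF 20] (2.12)–(2.13): the
new action is the old one read at the new field plus history-free brackets plus the new term
`𝐄^{(k+1)}(g_k, U_{k+1}) = log ∫dμ_{C^{(k)}}(B) χ_k exp[𝐏^{(k)}(g_k, U_{k+1}, B) + {𝐄_k(U_k(exp i[g_kCB − hD̃(g_kCB)]V^{(k)})) −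
𝐄_k(U_k(V^{(k)}))}]`; p. 298 [PDF 50]: *«although it depends also on all preceding coupling constants»*.  NOTHING
quantitative about the history dependence is printed (cell GAPS G-t4-U3-3).

WHAT THIS MODULE DOES (THEOREMS ONLY; no definition, no named fact).  It types the RECURSION that (0.23) + (2.13) describe,
as displayed hypotheses over the body of record, for TWO coupling histories `g, g′` with every coupling in a window `W`:
* per step `k` a step datum `D k : FluctData Y` (measures `dμ_{C^{(k)}(U)}`, cut-off `χ_k`, the explicit part `𝐏^{(k)}`; its
  own `Q`-field is not used), the two configuration maps of the curly bracket `τ k g_k U B` (= `U_k(exp i[g_kCB −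
  hD̃(g_kCB)]V^{(k)}(U))`) and `σ k U` (= `U_k(V^{(k)}(U))` = the map through which the old action is read at the new field),
  a history-free remainder `R k g_k U` (the brackets `−(1/g_k²)A`, `[log Z^{(k)}(U) − log Z^{(k)}(1)]`, `−𝐄^{(k+1)}(g_k, 1)` of
  (2.12), which involve the LAST coupling only), small-field domains `Dom k`;
* the total old action `E k g : Y → ℝ` of the history `g` after `k` steps, with NO history at step 0 (`hE0`, (0.23) has no
  `j = 0` term) and the recursion `hrec`:
  `E (k+1) g U = E k g (σ k U) + newTerm {D k with Q := [B ↦ E k g (τ k g_k U B) − E k g (σ k U)]} (g k) U + R k (g k) U`;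
* the located per-step inputs of `B12Eq213CouplingDependence.abs_newTerm_sub_newTerm_le_joint` displayed at every step
  (integrability, positivity, ONE `g_k`-Lipschitz constant `L` of the exponent on the small-field support, `L_R` for `R`),
  and the domain compatibilities `σ k (Dom (k+1)) ⊆ Dom k`, `τ k g_k U B ∈ Dom k` on the support of `χ_k`.
THEOREM `abs_action_sub_action_le_tower`: for every `k` and `U ∈ Dom k`,
`|E k g′ U − E k g U| ≤ Σ_{i<k} (L + L_R)·3^{k−1−i}·|g′ i − g i|` — the SHAPE of `T4OutputRate.NE9` (joint Lipschitz in the whole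
history) for the total action in the sup-currency, with moduli that GROW like `3^{age}` (one carried old action + two
evaluations in the curly bracket; `B12Eq213CouplingDependence.historyModuli_of_uniformStep`).  HONEST READING: this is the
a-priori bound the body yields with no localization; NE9's located content — moduli DECAYING in the age (`FadingMemory`, rate
`ω′ < 1`) for the LOCALIZED terms `𝐄^{(j)}(X)` — is exactly what the one-step cluster representation W1 ([II] §§1–2, the
OBJECT O-NE9-1) adds; cf. `T4HistoryLipschitzRecursion.ne9_and_fadingMemory_of_geometricStep` (rate `ω + c` from a per-step
contraction) and `sticky_not_fadingMemory`.  The β-shuffles of (0.23) (history-dependent through (5.42), node U2 ∕ NE4) are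
NOT modelled: `R` is taken history-free given the last coupling.

v1.1 (same seat, APPEND-ONLY; §1 byte-identical to p409692 ✓ 5452e47c8128): §2 `abs_step_le_of_lip`,
`abs_action_sub_action_le_tower_of_lip` — the same tower from a NEW-TERM-LEVEL last-coupling modulus per step (the currency the
Gaussian body supplies, `B12Eq213GaussianLastCoupling`), instead of the exponent-level one.

Every theorem is elementary ([folklore]-level real analysis composed with the seat's p409146 theorems); the `[cite: …]` tags
locate the printed recursion.  HONEST FRAMING: count-neutral Track-A side module; NOT a discharge of node N22; one finite T⁴
programme at fixed ε, Bałaban AS PRINTED with locators; nothing continuum ∕ ℝ⁴ ∕ OS ∕ mass-gap ∕ Clay.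
-/

noncomputable section

namespace Literature.MathematicalPhysics.QuantumFieldTheory.Balaban1983to89.B12Eq213HistoryTower

open _root_.MeasureTheory
open scoped BigOperators
open Literature.MathematicalPhysics.QuantumFieldTheory.Balaban1983to89
open Literature.MathematicalPhysics.QuantumFieldTheory.Balaban1983to89.B12Eq213Body268 (FluctData)
open Literature.MathematicalPhysics.QuantumFieldTheory.Balaban1983to89.B12Eq213CouplingDependence

variable {Y : Type*}

/-- **ONE STEP OF THE TOWER** (the induction step, isolated): if at step `k` the two histories' old actions are `s`-close on
`Dom k`, the step's inputs hold (integrability and positivity of the two (2.13) integrals at the new field `U ∈ Dom (k+1)`, one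
`g_k`-Lipschitz constant `L` of the second history's exponent on the support of `χ_k` between the two last couplings, `L_R` for
the history-free remainder, domain compatibilities), then the two NEW total actions are
`3s + (L + L_R)·|g′_k − g_k|`-close at `U`: one carried old action (`s`), the curly bracket twice (`2s`,
`abs_newTerm_sub_newTerm_le_of_oldActions` ∕ `abs_bracketDiff_le`), the last coupling (`L`, `L_R`).
[cite: Balaban1987RG1, (2.12)–(2.13) p.268 and §0 (0.23) p.256] -/
theorem abs_step_le (D : FluctData Y) (τ : ℝ → Y → D.𝓑 → Y) (σ : Y → Y) (R : ℝ → Y → ℝ) (Ek Ek' : Y → ℝ)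
    (S : Set Y) {s L LR gk gk' : ℝ} {U : Y} (hS : ∀ y ∈ S, |Ek' y - Ek y| ≤ s)
    (hσ : σ U ∈ S) (hτ : ∀ B, D.χ U B ≠ 0 → τ gk U B ∈ S)
    (hint : Integrable (FluctData.integrand { D with Q := fun a U B => Ek (τ a U B) - Ek (σ U) } gk U) (D.μ U))
    (hint'g : Integrable (FluctData.integrand { D with Q := fun a U B => Ek' (τ a U B) - Ek' (σ U) } gk U) (D.μ U))
    (hint'g' : Integrable (FluctData.integrand { D with Q := fun a U B => Ek' (τ a U B) - Ek' (σ U) } gk' U) (D.μ U))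
    (hpos : 0 < FluctData.integral { D with Q := fun a U B => Ek (τ a U B) - Ek (σ U) } gk U)
    (hpos' : 0 < FluctData.integral { D with Q := fun a U B => Ek' (τ a U B) - Ek' (σ U) } gk U)
    (hL : ∀ B, D.χ U B ≠ 0 →
      |FluctData.exponent { D with Q := fun a U B => Ek' (τ a U B) - Ek' (σ U) } gk' U B -
        FluctData.exponent { D with Q := fun a U B => Ek' (τ a U B) - Ek' (σ U) } gk U B| ≤ L * |gk' - gk|)
    (hR : |R gk' U - R gk U| ≤ LR * |gk' - gk|) :
    |(Ek' (σ U) + FluctData.newTerm { D with Q := fun a U B => Ek' (τ a U B) - Ek' (σ U) } gk' U + R gk' U) -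
      (Ek (σ U) + FluctData.newTerm { D with Q := fun a U B => Ek (τ a U B) - Ek (σ U) } gk U + R gk U)|
      ≤ 3 * s + (L + LR) * |gk' - gk| := by
  -- the curly brackets of the two histories are 2s-close on the support of χ_k
  have hr : ∀ B, D.χ U B ≠ 0 →
      |(fun a U B => Ek' (τ a U B) - Ek' (σ U)) gk U B - (fun a U B => Ek (τ a U B) - Ek (σ U)) gk U B| ≤ 2 * s :=
    fun B hB => abs_bracketDiff_le Ek Ek' S hS (hτ B hB) hσ
  have hN := abs_newTerm_sub_newTerm_le_joint { D with Q := fun a U B => Ek (τ a U B) - Ek (σ U) }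
    (fun a U B => Ek' (τ a U B) - Ek' (σ U)) hint hint'g hint'g' hpos hpos' hL hr
  have h1 : |Ek' (σ U) - Ek (σ U)| ≤ s := hS _ hσ
  have e : (Ek' (σ U) + FluctData.newTerm { D with Q := fun a U B => Ek' (τ a U B) - Ek' (σ U) } gk' U + R gk' U) -
      (Ek (σ U) + FluctData.newTerm { D with Q := fun a U B => Ek (τ a U B) - Ek (σ U) } gk U + R gk U)
      = (Ek' (σ U) - Ek (σ U)) +
        (FluctData.newTerm { D with Q := fun a U B => Ek' (τ a U B) - Ek' (σ U) } gk' U -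
          FluctData.newTerm { D with Q := fun a U B => Ek (τ a U B) - Ek (σ U) } gk U) +
        (R gk' U - R gk U) := by ring
  rw [e]
  calc |(Ek' (σ U) - Ek (σ U)) +
        (FluctData.newTerm { D with Q := fun a U B => Ek' (τ a U B) - Ek' (σ U) } gk' U -
          FluctData.newTerm { D with Q := fun a U B => Ek (τ a U B) - Ek (σ U) } gk U) +
        (R gk' U - R gk U)|
      ≤ |Ek' (σ U) - Ek (σ U)| +
        |FluctData.newTerm { D with Q := fun a U B => Ek' (τ a U B) - Ek' (σ U) } gk' U -
          FluctData.newTerm { D with Q := fun a U B => Ek (τ a U B) - Ek (σ U) } gk U| +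
        |R gk' U - R gk U| := abs_add_three _ _ _
    _ ≤ s + (L * |gk' - gk| + 2 * s) + LR * |gk' - gk| := add_le_add (add_le_add h1 hN) hR
    _ = 3 * s + (L + LR) * |gk' - gk| := by ring

/-- **THE TOWER THEOREM — A-PRIORI HISTORY-LIPSCHITZ BOUND OF THE TOTAL SMALL-FIELD ACTION.**  Data per step `k`: the step
datum `D k` (measures, `χ_k`, `𝐏^{(k)}`), the bracket's configuration maps `τ k`, `σ k`, the history-free remainder `R k`,
small-field domains `Dom k`; the total old action `E k g` of a history `g` after `k` steps.  Hypotheses (displayed): no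
history at step 0 (`hE0`, (0.23)); the recursion (2.12)–(2.13) read on the body (`hrec`); domain compatibilities; and, at every
step, for the two histories `g, g′` (all couplings in the window `W`), the located inputs of the one-step comparison — integrable
integrands, positive integrals, ONE `g_k`-Lipschitz constant `L` of the exponent `𝐏^{(k)} + {…}′` on the small-field support between
the two last couplings, `L_R` for the remainder.  CONCLUSION: for every `k` and every `U ∈ Dom k`,
`|E k g′ U − E k g U| ≤ Σ_{i<k} (L + L_R)·3^{k−1−i}·|g′ i − g i|` — joint Lipschitz dependence on the whole history
(p. 256, p. 298) with EXPLODING moduli: the body alone gives NE9's shape without fading memory. [cite: Balaban1987RG1, §0 (0.23) p.256, (2.12)–(2.13) p.268 and §5 p.298] -/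
theorem abs_action_sub_action_le_tower (D : ℕ → FluctData Y) (τ : (k : ℕ) → ℝ → Y → (D k).𝓑 → Y) (σ : ℕ → Y → Y)
    (R : ℕ → ℝ → Y → ℝ) (E : ℕ → (ℕ → ℝ) → Y → ℝ) (Dom : ℕ → Set Y) (W : Set ℝ) {L LR : ℝ} (g g' : ℕ → ℝ)
    (hg : ∀ k, g k ∈ W) (hg' : ∀ k, g' k ∈ W)
    (hE0 : ∀ U, E 0 g' U = E 0 g U)
    (hrec : ∀ (h : ℕ → ℝ) (k : ℕ) (U : Y), (∀ i, h i ∈ W) →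
      E (k + 1) h U = E k h (σ k U) +
        FluctData.newTerm { D k with Q := fun a U B => E k h (τ k a U B) - E k h (σ k U) } (h k) U + R k (h k) U)
    (hσ : ∀ k U, U ∈ Dom (k + 1) → σ k U ∈ Dom k)
    (hτ : ∀ k U, U ∈ Dom (k + 1) → ∀ a ∈ W, ∀ B, (D k).χ U B ≠ 0 → τ k a U B ∈ Dom k)
    (hint : ∀ (h : ℕ → ℝ) (k : ℕ), (∀ i, h i ∈ W) → ∀ U ∈ Dom (k + 1), ∀ a ∈ W,
      Integrable (FluctData.integrand { D k with Q := fun a U B => E k h (τ k a U B) - E k h (σ k U) } a U) ((D k).μ U))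
    (hpos : ∀ (h : ℕ → ℝ) (k : ℕ), (∀ i, h i ∈ W) → ∀ U ∈ Dom (k + 1), ∀ a ∈ W,
      0 < FluctData.integral { D k with Q := fun a U B => E k h (τ k a U B) - E k h (σ k U) } a U)
    (hL : ∀ (h : ℕ → ℝ) (k : ℕ), (∀ i, h i ∈ W) → ∀ U ∈ Dom (k + 1), ∀ B, (D k).χ U B ≠ 0 → ∀ a ∈ W, ∀ a' ∈ W,
      |FluctData.exponent { D k with Q := fun a U B => E k h (τ k a U B) - E k h (σ k U) } a' U B -
        FluctData.exponent { D k with Q := fun a U B => E k h (τ k a U B) - E k h (σ k U) } a U B| ≤ L * |a' - a|)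
    (hR : ∀ k, ∀ U ∈ Dom (k + 1), ∀ a ∈ W, ∀ a' ∈ W, |R k a' U - R k a U| ≤ LR * |a' - a|) :
    ∀ k, ∀ U ∈ Dom k, |E k g' U - E k g U| ≤ ∑ i ∈ Finset.range k, (L + LR) * 3 ^ (k - 1 - i) * |g' i - g i| := by
  -- the scalar majorant sequence and its recursion
  set s : ℕ → ℝ := fun k => ∑ i ∈ Finset.range k, (L + LR) * 3 ^ (k - 1 - i) * |g' i - g i| with hs
  have hs0 : s 0 = 0 := by simp [hs]
  have hstep : ∀ k, s (k + 1) = 3 * s k + (L + LR) * |g' k - g k| := by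
    intro k
    simp only [hs]
    rw [Finset.sum_range_succ, Finset.mul_sum]
    congr 1
    · refine Finset.sum_congr rfl fun i hi => ?_
      rw [Finset.mem_range] at hi
      have e : k + 1 - 1 - i = (k - 1 - i) + 1 := by omega
      rw [e, pow_succ]
      ring
    · have e : k + 1 - 1 - k = 0 := by omega
      rw [e, pow_zero, mul_one]
  -- induction on the step, uniformly on the domain
  suffices main : ∀ k, ∀ U ∈ Dom k, |E k g' U - E k g U| ≤ s k from main
  intro k
  induction k with
  | zero => intro U _; simp [hE0 U, hs0]
  | succ k ih =>
    intro U hU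
    rw [hrec g' k U hg', hrec g k U hg, hstep k]
    exact abs_step_le (D k) (τ k) (σ k) (R k) (E k g) (E k g') (Dom k) ih (hσ k U hU)
      (fun B hB => hτ k U hU (g k) (hg k) B hB)
      (hint g k hg U hU (g k) (hg k)) (hint g' k hg' U hU (g k) (hg k)) (hint g' k hg' U hU (g' k) (hg' k))
      (hpos g k hg U hU (g k) (hg k)) (hpos g' k hg' U hU (g k) (hg k))
      (fun B hB => hL g' k hg' U hU B hB (g k) (hg k) (g' k) (hg' k))
      (hR k U hU (g k) (hg k) (g' k) (hg' k))

/-- The NEWEST coupling enters with the constant `L + L_R`, the OLDEST with `(L + L_R)·3^{k−1}`: every modulus of the tower bound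
is at most `(L + L_R)·3^{k−1}` (for `0 ≤ L + L_R`), so the a-priori bound is uniform in the history length only against
`3^{age}`-summable coupling discrepancies — the quantitative reason the localized currency of [II] is needed for NE9's
`FadingMemory` (there the factor per step is a contraction `ω′ < 1`). [cite: Balaban1987RG1, §0 p.256 and §5 p.298] -/
theorem towerModulus_le {L LR : ℝ} (hL : 0 ≤ L + LR) {k i : ℕ} (hi : i < k) :
    (L + LR) * (3 : ℝ) ^ (k - 1 - i) ≤ (L + LR) * 3 ^ (k - 1) :=
  mul_le_mul_of_nonneg_left (pow_le_pow_right₀ (by norm_num) (by omega)) hL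

/-! ## §2 (v1.1, APPEND-ONLY; §1 byte-identical). The tower from a NEW-TERM-LEVEL last-coupling modulus

Why.  `abs_step_le` ∕ `abs_action_sub_action_le_tower` take the last-coupling input at the level of the EXPONENT (one uniform
`g_k`-Lipschitz constant of `𝐏^{(k)} + {…}` on the small-field support).  For the Gaussian body this is the wrong currency (the
exponent grows quadratically in `B` on the support, module `B12Eq213GaussianLastCoupling`): what one has there is a `g_k`-Lipschitz
constant of the NEW TERM itself on a coupling window (by the mean value theorem from `hasDerivAt_newTerm_gaussian_of_quadDom`).  The
variant below takes exactly that: per step, the second history's new term is `L`-Lipschitz in the last coupling on the window; the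
history bracket enters as before (`abs_newTerm_withQ_sub_newTerm_le` + `abs_bracketDiff_le`).  Same conclusion, moduli
`(L + L_R)·3^{k−1−i}`. -/

section TowerLip

variable {Y : Type*}

/-- **ONE STEP, NEW-TERM-LEVEL LAST-COUPLING MODULUS**: as `abs_step_le`, with the exponent-level Lipschitz hypothesis replaced by a
Lipschitz bound of the second history's new term between the two last couplings, `|𝐄′^{(k+1)}(g′_k, U) − 𝐄′^{(k+1)}(g_k, U)| ≤ L·|g′_k − g_k|`.
[cite: Balaban1987RG1, (2.12)–(2.13) p.268 and §0 (0.23) p.256] -/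
theorem abs_step_le_of_lip (D : FluctData Y) (τ : ℝ → Y → D.𝓑 → Y) (σ : Y → Y) (R : ℝ → Y → ℝ) (Ek Ek' : Y → ℝ)
    (S : Set Y) {s L LR gk gk' : ℝ} {U : Y} (hS : ∀ y ∈ S, |Ek' y - Ek y| ≤ s)
    (hσ : σ U ∈ S) (hτ : ∀ B, D.χ U B ≠ 0 → τ gk U B ∈ S)
    (hint : Integrable (FluctData.integrand { D with Q := fun a U B => Ek (τ a U B) - Ek (σ U) } gk U) (D.μ U))
    (hint'g : Integrable (FluctData.integrand { D with Q := fun a U B => Ek' (τ a U B) - Ek' (σ U) } gk U) (D.μ U))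
    (hpos : 0 < FluctData.integral { D with Q := fun a U B => Ek (τ a U B) - Ek (σ U) } gk U)
    (hN : |FluctData.newTerm { D with Q := fun a U B => Ek' (τ a U B) - Ek' (σ U) } gk' U -
        FluctData.newTerm { D with Q := fun a U B => Ek' (τ a U B) - Ek' (σ U) } gk U| ≤ L * |gk' - gk|)
    (hR : |R gk' U - R gk U| ≤ LR * |gk' - gk|) :
    |(Ek' (σ U) + FluctData.newTerm { D with Q := fun a U B => Ek' (τ a U B) - Ek' (σ U) } gk' U + R gk' U) -
      (Ek (σ U) + FluctData.newTerm { D with Q := fun a U B => Ek (τ a U B) - Ek (σ U) } gk U + R gk U)|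
      ≤ 3 * s + (L + LR) * |gk' - gk| := by
  have hr : ∀ B, D.χ U B ≠ 0 →
      |(fun a U B => Ek' (τ a U B) - Ek' (σ U)) gk U B - (fun a U B => Ek (τ a U B) - Ek (σ U)) gk U B| ≤ 2 * s :=
    fun B hB => abs_bracketDiff_le Ek Ek' S hS (hτ B hB) hσ
  have h2 : |FluctData.newTerm { D with Q := fun a U B => Ek' (τ a U B) - Ek' (σ U) } gk U -
      FluctData.newTerm { D with Q := fun a U B => Ek (τ a U B) - Ek (σ U) } gk U| ≤ 2 * s :=
    abs_newTerm_withQ_sub_newTerm_le { D with Q := fun a U B => Ek (τ a U B) - Ek (σ U) }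
      (fun a U B => Ek' (τ a U B) - Ek' (σ U)) hint hint'g hpos hr
  have h1 : |Ek' (σ U) - Ek (σ U)| ≤ s := hS _ hσ
  have e : (Ek' (σ U) + FluctData.newTerm { D with Q := fun a U B => Ek' (τ a U B) - Ek' (σ U) } gk' U + R gk' U) -
      (Ek (σ U) + FluctData.newTerm { D with Q := fun a U B => Ek (τ a U B) - Ek (σ U) } gk U + R gk U)
      = (Ek' (σ U) - Ek (σ U)) +
        ((FluctData.newTerm { D with Q := fun a U B => Ek' (τ a U B) - Ek' (σ U) } gk' U -
            FluctData.newTerm { D with Q := fun a U B => Ek' (τ a U B) - Ek' (σ U) } gk U) +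
          (FluctData.newTerm { D with Q := fun a U B => Ek' (τ a U B) - Ek' (σ U) } gk U -
            FluctData.newTerm { D with Q := fun a U B => Ek (τ a U B) - Ek (σ U) } gk U)) +
        (R gk' U - R gk U) := by ring
  rw [e]
  calc |(Ek' (σ U) - Ek (σ U)) +
        ((FluctData.newTerm { D with Q := fun a U B => Ek' (τ a U B) - Ek' (σ U) } gk' U -
            FluctData.newTerm { D with Q := fun a U B => Ek' (τ a U B) - Ek' (σ U) } gk U) +
          (FluctData.newTerm { D with Q := fun a U B => Ek' (τ a U B) - Ek' (σ U) } gk U -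
            FluctData.newTerm { D with Q := fun a U B => Ek (τ a U B) - Ek (σ U) } gk U)) +
        (R gk' U - R gk U)|
      ≤ |Ek' (σ U) - Ek (σ U)| +
        |(FluctData.newTerm { D with Q := fun a U B => Ek' (τ a U B) - Ek' (σ U) } gk' U -
            FluctData.newTerm { D with Q := fun a U B => Ek' (τ a U B) - Ek' (σ U) } gk U) +
          (FluctData.newTerm { D with Q := fun a U B => Ek' (τ a U B) - Ek' (σ U) } gk U -
            FluctData.newTerm { D with Q := fun a U B => Ek (τ a U B) - Ek (σ U) } gk U)| +
        |R gk' U - R gk U| := abs_add_three _ _ _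
    _ ≤ s + (L * |gk' - gk| + 2 * s) + LR * |gk' - gk| :=
        add_le_add (add_le_add h1 ((abs_add_le _ _).trans (add_le_add hN h2))) hR
    _ = 3 * s + (L + LR) * |gk' - gk| := by ring

/-- **THE TOWER THEOREM FROM A NEW-TERM-LEVEL LAST-COUPLING MODULUS**: as `abs_action_sub_action_le_tower`, with the per-step
exponent-level hypothesis `hL` replaced by `hN` — at every step, for every history `h` in the window and every `U ∈ Dom (k+1)`, the
new term `a ↦ 𝐄^{(k+1)}_h(a, U)` is `L`-Lipschitz between any two couplings of the window (for the Gaussian body: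
`B12Eq213GaussianLastCoupling`'s effective constant).  Conclusion unchanged: `|E k g′ U − E k g U| ≤ Σ_{i<k} (L + L_R)·3^{k−1−i}·|g′ i − g i|`
on `Dom k`. [cite: Balaban1987RG1, §0 (0.23) p.256, (2.12)–(2.13) p.268 and §5 p.298] -/
theorem abs_action_sub_action_le_tower_of_lip (D : ℕ → FluctData Y) (τ : (k : ℕ) → ℝ → Y → (D k).𝓑 → Y)
    (σ : ℕ → Y → Y) (R : ℕ → ℝ → Y → ℝ) (E : ℕ → (ℕ → ℝ) → Y → ℝ) (Dom : ℕ → Set Y) (W : Set ℝ) {L LR : ℝ}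
    (g g' : ℕ → ℝ) (hg : ∀ k, g k ∈ W) (hg' : ∀ k, g' k ∈ W)
    (hE0 : ∀ U, E 0 g' U = E 0 g U)
    (hrec : ∀ (h : ℕ → ℝ) (k : ℕ) (U : Y), (∀ i, h i ∈ W) →
      E (k + 1) h U = E k h (σ k U) +
        FluctData.newTerm { D k with Q := fun a U B => E k h (τ k a U B) - E k h (σ k U) } (h k) U + R k (h k) U)
    (hσ : ∀ k U, U ∈ Dom (k + 1) → σ k U ∈ Dom k)
    (hτ : ∀ k U, U ∈ Dom (k + 1) → ∀ a ∈ W, ∀ B, (D k).χ U B ≠ 0 → τ k a U B ∈ Dom k)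
    (hint : ∀ (h : ℕ → ℝ) (k : ℕ), (∀ i, h i ∈ W) → ∀ U ∈ Dom (k + 1), ∀ a ∈ W,
      Integrable (FluctData.integrand { D k with Q := fun a U B => E k h (τ k a U B) - E k h (σ k U) } a U) ((D k).μ U))
    (hpos : ∀ (h : ℕ → ℝ) (k : ℕ), (∀ i, h i ∈ W) → ∀ U ∈ Dom (k + 1), ∀ a ∈ W,
      0 < FluctData.integral { D k with Q := fun a U B => E k h (τ k a U B) - E k h (σ k U) } a U)
    (hN : ∀ (h : ℕ → ℝ) (k : ℕ), (∀ i, h i ∈ W) → ∀ U ∈ Dom (k + 1), ∀ a ∈ W, ∀ a' ∈ W,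
      |FluctData.newTerm { D k with Q := fun a U B => E k h (τ k a U B) - E k h (σ k U) } a' U -
        FluctData.newTerm { D k with Q := fun a U B => E k h (τ k a U B) - E k h (σ k U) } a U| ≤ L * |a' - a|)
    (hR : ∀ k, ∀ U ∈ Dom (k + 1), ∀ a ∈ W, ∀ a' ∈ W, |R k a' U - R k a U| ≤ LR * |a' - a|) :
    ∀ k, ∀ U ∈ Dom k, |E k g' U - E k g U| ≤ ∑ i ∈ Finset.range k, (L + LR) * 3 ^ (k - 1 - i) * |g' i - g i| := by
  set s : ℕ → ℝ := fun k => ∑ i ∈ Finset.range k, (L + LR) * 3 ^ (k - 1 - i) * |g' i - g i| with hs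
  have hs0 : s 0 = 0 := by simp [hs]
  have hstep : ∀ k, s (k + 1) = 3 * s k + (L + LR) * |g' k - g k| := by
    intro k
    simp only [hs]
    rw [Finset.sum_range_succ, Finset.mul_sum]
    congr 1
    · refine Finset.sum_congr rfl fun i hi => ?_
      rw [Finset.mem_range] at hi
      have e : k + 1 - 1 - i = (k - 1 - i) + 1 := by omega
      rw [e, pow_succ]
      ring
    · have e : k + 1 - 1 - k = 0 := by omega
      rw [e, pow_zero, mul_one]
  suffices main : ∀ k, ∀ U ∈ Dom k, |E k g' U - E k g U| ≤ s k from main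
  intro k
  induction k with
  | zero => intro U _; simp [hE0 U, hs0]
  | succ k ih =>
    intro U hU
    rw [hrec g' k U hg', hrec g k U hg, hstep k]
    exact abs_step_le_of_lip (D k) (τ k) (σ k) (R k) (E k g) (E k g') (Dom k) ih (hσ k U hU)
      (fun B hB => hτ k U hU (g k) (hg k) B hB)
      (hint g k hg U hU (g k) (hg k)) (hint g' k hg' U hU (g k) (hg k))
      (hpos g k hg U hU (g k) (hg k))
      (hN g' k hg' U hU (g k) (hg k) (g' k) (hg' k))
      (hR k U hU (g k) (hg k) (g' k) (hg' k))

end TowerLip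

end Literature.MathematicalPhysics.QuantumFieldTheory.Balaban1983to89.B12Eq213HistoryTower
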